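import Literature.MathematicalPhysics.QuantumLattice.ApproximateEigenvectorLemmas
import HarnessLib

/-!
# The gap hypothesis of a ground-state enclosure from a PSD certificate in coordinates

Companion of `GroundStateEnclosure.lean` (Davis–Kahan for the lowest eigenvector: a lower bound
`θ` on the quadratic form of `H` on `W ∩ y^⊥` controls the distance of the trial vector `y` from the
true eigenvector). In an exact-diagonalisation certificate the subspace `W` comes with an
ORTHOGONAL family `b : ι → (n → ℂ)` spanning it (typically indicator sums of the orbits of a
symmetry group, `⟨b_i, b_i⟩ = N_i` = orbit size), the Hamiltonian acts on the family by a real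
matrix, `H b_j = Σ_i C_{ij} b_i` (counts of hops between orbits), and the trial vector has real
coordinates, `y = Σ_i w_i b_i`. Then the form bound on `W ∩ y^⊥` is exactly positivity of one real
quadratic form in the coordinates:

* `re_form_ge_of_coordinate_certificate` — if
  `0 ≤ Σ_{ij} u_i N_i C_{ij} u_j - θ Σ_i N_i u_i² + α (Σ_i N_i w_i u_i)²` for every REAL vector `u`
  (positivity of `N C - θ N + α (N w)(N w)ᵀ`, e.g. by an exact `LDLᵀ` factorisation checked in the
  kernel), then `θ ‖φ‖² ≤ Re⟨φ, H φ⟩` for every `φ ∈ span b` with `⟨y, φ⟩ = 0`.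

No Hermitian hypothesis is needed (real and imaginary parts of the complex coordinates are treated
separately). Elementary linear algebra (Parlett (1998) §10–11 for the certificate practice); the
coordinate vocabulary is that of `ApproximateEigenvectorLemmas.lean`. No definition; sorry-free.
-/

noncomputable section

open Matrix Complex Finset
open scoped ComplexOrder ComplexConjugate

namespace Literature.MathematicalPhysics.QuantumLattice

variable {n : Type*} [Fintype n] {ι : Type*} [Fintype ι]

omit [Fintype ι] in
/-- `Re (conj a · c · r) = (Re a Re c + Im a Im c) r` for real `r`. [folklore] -/
theorem re_conj_mul_mul_ofReal (a c : ℂ) (r : ℝ) :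
    ((starRingEnd ℂ) a * (c * (r : ℂ))).re = (a.re * c.re + a.im * c.im) * r := by
  simp only [Complex.mul_re, Complex.mul_im, Complex.conj_re, Complex.conj_im, Complex.ofReal_re,
    Complex.ofReal_im, mul_zero, sub_zero]
  ring

/-- Inner products against an orthogonal family: `⟨b_i, Σ_j z_j b_j⟩ = z_i N_i`. [folklore] -/
theorem star_dotProduct_sum_smul_of_orthogonal (b : ι → (n → ℂ))
    (horth : ∀ i j, i ≠ j → star (b i) ⬝ᵥ (b j) = 0) (N : ι → ℝ)
    (hN : ∀ i, star (b i) ⬝ᵥ (b i) = (N i : ℂ)) (z : ι → ℂ) (i : ι) :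
    star (b i) ⬝ᵥ (∑ j, z j • b j) = z i * (N i : ℂ) := by
  rw [dotProduct_sum]
  simp_rw [dotProduct_smul, smul_eq_mul]
  rw [Finset.sum_eq_single i (fun j _ hji => by rw [horth i j (Ne.symm hji), mul_zero])
    (fun h => absurd (Finset.mem_univ i) h), hN]

/-- **The gap hypothesis from a PSD certificate in coordinates.** Let `b : ι → (n → ℂ)` be a
pairwise orthogonal family with `⟨b_i, b_i⟩ = N_i`, let `H` act on it by a real matrix,
`H b_j = Σ_i C_{ij} b_i`, and let `y = Σ_i w_i b_i` with real `w`. If for every real vector `u`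
`0 ≤ Σ_{i,j} u_i (N_i C_{ij}) u_j - θ Σ_i N_i u_i² + α (Σ_i N_i w_i u_i)²`, then
`θ Re⟨φ, φ⟩ ≤ Re⟨φ, H φ⟩` for every `φ` in the span of `b` orthogonal to `y`. (Write
`φ = Σ z_j b_j`, `z = u + iv`; then `Re⟨φ,Hφ⟩ = Σ N_i C_{ij}(u_iu_j + v_iv_j)`, `⟨φ,φ⟩ = Σ N_i(u_i²+v_i²)`,
and `⟨y,φ⟩ = 0` kills the rank-one term for both `u` and `v`.) This is the hypothesis `hgap` of
`GroundStateEnclosure.re_form_ge_of_orthogonal_eigenvector` / `eucNorm_sub_proj_le_of_residual`.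
[folklore] -/
theorem re_form_ge_of_coordinate_certificate (b : ι → (n → ℂ))
    (horth : ∀ i j, i ≠ j → star (b i) ⬝ᵥ (b j) = 0) (N : ι → ℝ)
    (hN : ∀ i, star (b i) ⬝ᵥ (b i) = (N i : ℂ)) (H : Matrix n n ℂ) (C : Matrix ι ι ℝ)
    (hC : ∀ j, H *ᵥ b j = ∑ i, (C i j : ℂ) • b i) (w : ι → ℝ) (θ α : ℝ)
    (hPSD : ∀ u : ι → ℝ, 0 ≤ ∑ i, ∑ j, u i * (N i * C i j) * u j - θ * ∑ i, N i * u i ^ 2 +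
      α * (∑ i, N i * w i * u i) ^ 2) :
    ∀ φ ∈ Submodule.span ℂ (Set.range b), star (∑ i, ((w i : ℝ) : ℂ) • b i) ⬝ᵥ φ = 0 →
      θ * (star φ ⬝ᵥ φ).re ≤ (star φ ⬝ᵥ (H *ᵥ φ)).re := by
  intro φ hφW hyφ
  obtain ⟨z, hz⟩ := (Submodule.mem_span_range_iff_exists_fun ℂ).mp hφW
  have hφ : φ = ∑ j, z j • b j := hz.symm
  -- inner products against the family
  have hbφ : ∀ i, star (b i) ⬝ᵥ φ = z i * (N i : ℂ) := fun i => by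
    rw [hφ]; exact star_dotProduct_sum_smul_of_orthogonal b horth N hN z i
  have hbH : ∀ i j, star (b i) ⬝ᵥ (H *ᵥ b j) = (C i j : ℂ) * (N i : ℂ) := fun i j => by
    rw [hC j]; exact star_dotProduct_sum_smul_of_orthogonal b horth N hN _ i
  have hbHφ : ∀ i, star (b i) ⬝ᵥ (H *ᵥ φ) = (∑ j, (C i j : ℂ) * z j) * (N i : ℂ) := fun i => by
    rw [hφ, mulVec_sum, dotProduct_sum, Finset.sum_mul]
    refine Finset.sum_congr rfl fun j _ => ?_
    rw [mulVec_smul, dotProduct_smul, hbH i j, smul_eq_mul]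
    ring
  -- expand `⟨φ, φ⟩`, `⟨φ, Hφ⟩`, `⟨y, φ⟩` along `star φ = Σ conj z_i • star b_i`
  have hstar : ∀ c : ι → ℂ, star (∑ i, c i • b i) = ∑ i, (starRingEnd ℂ) (c i) • star (b i) := by
    intro c
    rw [star_sum]
    refine Finset.sum_congr rfl fun i _ => ?_
    rw [star_smul, Complex.star_def]
  have hexp : ∀ (c : ι → ℂ) (v : n → ℂ),
      star (∑ i, c i • b i) ⬝ᵥ v = ∑ i, (starRingEnd ℂ) (c i) * (star (b i) ⬝ᵥ v) := by
    intro c v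
    rw [hstar, sum_dotProduct]
    refine Finset.sum_congr rfl fun i _ => ?_
    rw [smul_dotProduct, smul_eq_mul]
  have hφφ : star φ ⬝ᵥ φ = ∑ i, (starRingEnd ℂ) (z i) * (z i * (N i : ℂ)) := by
    conv_lhs => rw [hφ]
    rw [hexp]
    exact Finset.sum_congr rfl fun i _ => by rw [← hφ, hbφ i]
  have hφH : star φ ⬝ᵥ (H *ᵥ φ) =
      ∑ i, (starRingEnd ℂ) (z i) * ((∑ j, (C i j : ℂ) * z j) * (N i : ℂ)) := by
    conv_lhs => rw [hφ]
    rw [hexp]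
    exact Finset.sum_congr rfl fun i _ => by rw [← hφ, hbHφ i]
  have hyφ' : ∑ i, (w i : ℂ) * (z i * (N i : ℂ)) = 0 := by
    rw [hexp] at hyφ
    rw [← hyφ]
    refine Finset.sum_congr rfl fun i _ => ?_
    rw [hbφ i, Complex.conj_ofReal]
  -- real and imaginary coordinates
  set u : ι → ℝ := fun i => (z i).re with hu
  set v : ι → ℝ := fun i => (z i).im with hv
  have hφφre : (star φ ⬝ᵥ φ).re = ∑ i, N i * u i ^ 2 + ∑ i, N i * v i ^ 2 := by
    rw [hφφ, Complex.re_sum, ← Finset.sum_add_distrib]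
    refine Finset.sum_congr rfl fun i _ => ?_
    rw [re_conj_mul_mul_ofReal]
    simp only [hu, hv]
    ring
  have hφHre : (star φ ⬝ᵥ (H *ᵥ φ)).re =
      ∑ i, ∑ j, u i * (N i * C i j) * u j + ∑ i, ∑ j, v i * (N i * C i j) * v j := by
    rw [hφH, Complex.re_sum, ← Finset.sum_add_distrib]
    refine Finset.sum_congr rfl fun i _ => ?_
    rw [re_conj_mul_mul_ofReal, Complex.re_sum, Complex.im_sum, Finset.mul_sum, Finset.mul_sum,
      ← Finset.sum_add_distrib, Finset.sum_mul, ← Finset.sum_add_distrib]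
    refine Finset.sum_congr rfl fun j _ => ?_
    simp only [Complex.mul_re, Complex.mul_im, Complex.ofReal_re, Complex.ofReal_im, zero_mul,
      sub_zero, add_zero, hu, hv]
    ring
  have hyu : ∑ i, N i * w i * u i = 0 := by
    have h := congrArg Complex.re hyφ'
    rw [Complex.re_sum, Complex.zero_re] at h
    rw [← h]
    refine Finset.sum_congr rfl fun i _ => ?_
    simp only [Complex.mul_re, Complex.mul_im, Complex.ofReal_re, Complex.ofReal_im, zero_mul,
      sub_zero, hu]
    ring
  have hyv : ∑ i, N i * w i * v i = 0 := by
    have h := congrArg Complex.im hyφ'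
    rw [Complex.im_sum, Complex.zero_im] at h
    rw [← h]
    refine Finset.sum_congr rfl fun i _ => ?_
    simp only [Complex.mul_re, Complex.mul_im, Complex.ofReal_re, Complex.ofReal_im, zero_mul,
      add_zero, hv]
    ring
  have hPu := hPSD u
  have hPv := hPSD v
  rw [hyu] at hPu
  rw [hyv] at hPv
  rw [hφφre, hφHre]
  nlinarith [hPu, hPv]

/-! ### Parameter cells: affine families are controlled by their endpoints

For a Hamiltonian depending affinely on a parameter, `H(t) = H₀ + t H₁` (e.g. the anisotropy `Δ` of
an XXZ model), with a trial vector and shift FIXED on a cell `t ∈ [lo, hi]`, the three inputs of the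
enclosure are affine (`PSD` form, Rayleigh quotient) or convex (residual norm) in `t`, so checking
the two ENDPOINTS certifies the whole cell. -/

omit [Fintype ι] in
/-- An affine real function nonnegative at the endpoints of an interval is nonnegative on it.
[folklore] -/
theorem affine_nonneg_of_endpoints {E₀ E₁ lo hi t : ℝ} (hlo : 0 ≤ E₀ + lo * E₁)
    (hhi : 0 ≤ E₀ + hi * E₁) (ht : t ∈ Set.Icc lo hi) : 0 ≤ E₀ + t * E₁ := by
  obtain ⟨h1, h2⟩ := ht
  rcases eq_or_lt_of_le (h1.trans h2) with heq | hlt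
  · have : t = lo := le_antisymm (heq ▸ h2) h1
    rw [this]; exact hlo
  · have key : 0 ≤ (hi - t) * (E₀ + lo * E₁) + (t - lo) * (E₀ + hi * E₁) :=
      add_nonneg (mul_nonneg (by linarith) hlo) (mul_nonneg (by linarith) hhi)
    have e : (hi - t) * (E₀ + lo * E₁) + (t - lo) * (E₀ + hi * E₁) = (hi - lo) * (E₀ + t * E₁) := by
      ring
    rw [e] at key
    exact nonneg_of_mul_nonneg_right key (by linarith)

omit [Fintype ι] in
/-- An affine real function below `θ` at the endpoints of an interval is below `θ` on it (for the
Rayleigh quotient `⟨y, H(t) y⟩ = r₀ + t r₁ < θ` on a cell). [folklore] -/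
theorem affine_lt_of_endpoints {r₀ r₁ lo hi t θ : ℝ} (hlo : r₀ + lo * r₁ < θ)
    (hhi : r₀ + hi * r₁ < θ) (ht : t ∈ Set.Icc lo hi) : r₀ + t * r₁ < θ := by
  obtain ⟨h1, h2⟩ := ht
  rcases eq_or_lt_of_le (h1.trans h2) with heq | hlt
  · have : t = lo := le_antisymm (heq ▸ h2) h1
    rw [this]; exact hlo
  · have key : 0 < (hi - t) * (θ - (r₀ + lo * r₁)) + (t - lo) * (θ - (r₀ + hi * r₁)) := by
      rcases eq_or_lt_of_le h1 with h1' | h1'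
      · rw [← h1', sub_self, zero_mul, add_zero]
        exact mul_pos (by linarith) (by linarith)
      · exact add_pos_of_nonneg_of_pos (mul_nonneg (by linarith) (by linarith))
          (mul_pos (by linarith) (by linarith))
    have e : (hi - t) * (θ - (r₀ + lo * r₁)) + (t - lo) * (θ - (r₀ + hi * r₁)) =
        (hi - lo) * (θ - (r₀ + t * r₁)) := by ring
    rw [e] at key
    have h3 : 0 < θ - (r₀ + t * r₁) := (mul_pos_iff_of_pos_left (show (0:ℝ) < hi - lo by linarith)).mp key
    linarith

/-- **The coordinate certificate on a parameter cell from its endpoints.** If the real form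
`Σ u_i N_i (C₀ + t C₁)_{ij} u_j - θ Σ N_i u_i² + α (Σ N_i w_i u_i)²` is nonnegative for all `u` at
`t = lo` and at `t = hi`, it is nonnegative for all `u` at every `t ∈ [lo, hi]` (affine in `t`):
the hypothesis `hPSD` of `re_form_ge_of_coordinate_certificate` for `H(t) = H₀ + t H₁` acting by
`C₀ + t C₁` on the orbit basis, on the whole cell. [folklore] -/
theorem coordinate_certificate_on_cell (N : ι → ℝ) (C₀ C₁ : Matrix ι ι ℝ) (w : ι → ℝ)
    (θ α lo hi : ℝ)
    (hlo : ∀ u : ι → ℝ, 0 ≤ ∑ i, ∑ j, u i * (N i * (C₀ i j + lo * C₁ i j)) * u j -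
      θ * ∑ i, N i * u i ^ 2 + α * (∑ i, N i * w i * u i) ^ 2)
    (hhi : ∀ u : ι → ℝ, 0 ≤ ∑ i, ∑ j, u i * (N i * (C₀ i j + hi * C₁ i j)) * u j -
      θ * ∑ i, N i * u i ^ 2 + α * (∑ i, N i * w i * u i) ^ 2)
    {t : ℝ} (ht : t ∈ Set.Icc lo hi) (u : ι → ℝ) :
    0 ≤ ∑ i, ∑ j, u i * (N i * (C₀ i j + t * C₁ i j)) * u j -
      θ * ∑ i, N i * u i ^ 2 + α * (∑ i, N i * w i * u i) ^ 2 := by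
  -- the form is `E₀ + s E₁` at parameter `s`
  have hsplit : ∀ s : ℝ, ∑ i, ∑ j, u i * (N i * (C₀ i j + s * C₁ i j)) * u j =
      ∑ i, ∑ j, u i * (N i * C₀ i j) * u j + s * ∑ i, ∑ j, u i * (N i * C₁ i j) * u j := by
    intro s
    rw [Finset.mul_sum, ← Finset.sum_add_distrib]
    refine Finset.sum_congr rfl fun i _ => ?_
    rw [Finset.mul_sum, ← Finset.sum_add_distrib]
    refine Finset.sum_congr rfl fun j _ => ?_
    ring
  have h0 := hlo u
  have h1 := hhi u
  rw [hsplit] at h0 h1 ⊢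
  have := affine_nonneg_of_endpoints
    (E₀ := ∑ i, ∑ j, u i * (N i * C₀ i j) * u j - θ * ∑ i, N i * u i ^ 2 +
      α * (∑ i, N i * w i * u i) ^ 2)
    (E₁ := ∑ i, ∑ j, u i * (N i * C₁ i j) * u j) (lo := lo) (hi := hi) (t := t)
    (by linarith) (by linarith) ht
  linarith

omit [Fintype ι] in
/-- **The residual on a parameter cell from its endpoints**: the Euclidean norm of an affine family
of vectors is bounded on `[lo, hi]` by the larger endpoint value (convexity), e.g. the residual
`(H(t) - ρ) y = (H₀ - ρ) y + t (H₁ y)` of a fixed trial vector. [folklore] -/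
theorem eucNorm_affine_le_max (v₀ v₁ : n → ℂ) {lo hi t : ℝ} (ht : t ∈ Set.Icc lo hi) :
    eucNorm (v₀ + (t : ℂ) • v₁) ≤
      max (eucNorm (v₀ + (lo : ℂ) • v₁)) (eucNorm (v₀ + (hi : ℂ) • v₁)) := by
  obtain ⟨h1, h2⟩ := ht
  rcases eq_or_lt_of_le (h1.trans h2) with heq | hlt
  · have : t = lo := le_antisymm (heq ▸ h2) h1
    rw [this]; exact le_max_left _ _
  · set s : ℝ := (t - lo) / (hi - lo) with hs
    have hd : 0 < hi - lo := by linarith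
    have hs0 : 0 ≤ s := div_nonneg (by linarith) hd.le
    have hs1 : s ≤ 1 := (div_le_one hd).mpr (by linarith)
    have ht' : t = lo + s * (hi - lo) := by rw [hs, div_mul_cancel₀ _ hd.ne']; ring
    have hdec : v₀ + (t : ℂ) • v₁ =
        ((1 - s : ℝ) : ℂ) • (v₀ + (lo : ℂ) • v₁) + ((s : ℝ) : ℂ) • (v₀ + (hi : ℂ) • v₁) := by
      rw [ht', smul_add, smul_add, smul_smul, smul_smul, add_add_add_comm, ← add_smul, ← add_smul]
      push_cast
      congr 1
      · rw [show (1 - (s : ℂ) + s) = 1 by ring, one_smul]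
      · congr 1; ring
    rw [hdec]
    calc eucNorm (((1 - s : ℝ) : ℂ) • (v₀ + (lo : ℂ) • v₁) + ((s : ℝ) : ℂ) • (v₀ + (hi : ℂ) • v₁))
        ≤ eucNorm (((1 - s : ℝ) : ℂ) • (v₀ + (lo : ℂ) • v₁)) +
            eucNorm (((s : ℝ) : ℂ) • (v₀ + (hi : ℂ) • v₁)) := eucNorm_add_le _ _
      _ = (1 - s) * eucNorm (v₀ + (lo : ℂ) • v₁) + s * eucNorm (v₀ + (hi : ℂ) • v₁) := by
          rw [eucNorm_smul, eucNorm_smul, Complex.norm_real, Complex.norm_real,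
            Real.norm_of_nonneg (by linarith), Real.norm_of_nonneg hs0]
      _ ≤ (1 - s) * max (eucNorm (v₀ + (lo : ℂ) • v₁)) (eucNorm (v₀ + (hi : ℂ) • v₁)) +
            s * max (eucNorm (v₀ + (lo : ℂ) • v₁)) (eucNorm (v₀ + (hi : ℂ) • v₁)) :=
          add_le_add (mul_le_mul_of_nonneg_left (le_max_left _ _) (by linarith))
            (mul_le_mul_of_nonneg_left (le_max_right _ _) hs0)
      _ = max (eucNorm (v₀ + (lo : ℂ) • v₁)) (eucNorm (v₀ + (hi : ℂ) • v₁)) := by ring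

end Literature.MathematicalPhysics.QuantumLattice

end
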